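import Literature.NumberTheory.Automorphic.HyperspecialUnitaryCartanFrames
import HarnessLib

/-!
# Cartan decomposition of the quasi-split unitary group `U(J₀)(K)`, `J₀ = antidiag(1,…,1)`, relative to its
# hyperspecial subgroup `K₀ = U(J₀) ∩ GL_N(𝒪)` — II: matrix form (Tits 1979 §3.3.3; Bruhat–Tits 1972 §4.4)

Topic `NumberTheory/Automorphic`; namespace `Literature.NumberTheory.Automorphic.HermitianLattice`.
THEOREMS only; no definition, no named fact, no `sorry`.  Sequel of `HyperspecialUnitaryCartanFrames`.

* `v_le_one_of_map_stdLattice_eq` — `A 𝒪^N = 𝒪^N` forces `A, A⁻¹ ∈ M_N(𝒪)`;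
* `exists_cartan_antidiagonal` — **Cartan decomposition**: under `LocalConjDatum σ ϖ` (involution `σ` preserving
  the valuation, `σ`-fixed uniformiser, `2 ∈ 𝒪ˣ`, Hensel) — and `UnramifiedLocalConjDatum.exists_cartan_antidiagonal`
  under the dyadic-capable `UnramifiedLocalConjDatum σ ϖ` ((trace) + (norm)), of which the former is the
  specialisation — for every `g ∈ U(σ, J₀) = unitaryGroupOfForm σ
  ((StdForm.antidiagonal N).over K)` there are `k₁, k₂ ∈ U(σ, J₀)` with integral entries and integral inverses and
  `d : Fin N → K` with `σ (d i) = d i`, `d i · d (rev i) = 1`, such that `k₁ g k₂ = diag(d)`.  (From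
  `exists_frame_cartan` at `S = univ`, `M = g 𝒪^N`: `g 𝒪^N = ψ(diag(d) 𝒪^N)` with `ψ ∈ U(J₀)`, `ψ 𝒪^N = 𝒪^N`, so
  `k := diag(d)⁻¹ ψ⁻¹ g` stabilises `𝒪^N`, and `ψ⁻¹ g k⁻¹ = diag(d)`.)

This is sub-stub (2b) `CartanAntidiag` of the line `b4-hyperspecial-gelfand-pair` (cell hodgecm-mathlib, row IV-9
`HyperspecialGelfandPair`) in the abstract local setting; the instance at a non-split unramified non-dyadic place
`w` of a quadratic extension of number fields is `HyperspecialUnitaryCartanAdicCompletion`.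

References: J. Tits, *Reductive groups over local fields*, PSPUM 33.1 (1979), §3.3.3 [Tits1979];
F. Bruhat, J. Tits, *Groupes réductifs sur un corps local I*, Publ. IHÉS 41 (1972), §4.4 [BruhatTits1972];
O. T. O'Meara, *Introduction to Quadratic Forms* (1963), §81A [Omeara1963].
-/

noncomputable section

open scoped Valued WithZero Matrix

namespace Literature.NumberTheory.Automorphic.HermitianLattice

variable {K : Type*} [Field K] [Valued K ℤᵐ⁰] {σ : K →+* K} {ϖ : K} {N : ℕ}

/-! ## §4 The Cartan decomposition in matrix form -/

/-- Images of `𝒪`-lattices under matrices compose. [cite: Omeara1963, §81A] -/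
theorem map_toLin'_mul (A B : Matrix (Fin N) (Fin N) K) (L : Submodule 𝒪[K] (Fin N → K)) :
    L.map ((Matrix.toLin' (A * B)).restrictScalars 𝒪[K]) =
      (L.map ((Matrix.toLin' B).restrictScalars 𝒪[K])).map ((Matrix.toLin' A).restrictScalars 𝒪[K]) := by
  rw [Matrix.toLin'_mul, ← Submodule.map_comp]; rfl

/-- `L.map 1 = L`. [cite: Omeara1963, §81A] -/
theorem map_toLin'_one (L : Submodule 𝒪[K] (Fin N → K)) :
    L.map ((Matrix.toLin' (1 : Matrix (Fin N) (Fin N) K)).restrictScalars 𝒪[K]) = L := by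
  rw [Matrix.toLin'_one, restrictScalars_id, Submodule.map_id]

/-- **`A 𝒪^N = 𝒪^N` forces `A, A⁻¹ ∈ M_N(𝒪)`** (columns `A e_j ∈ 𝒪^N`, and `A⁻¹ e_j` is the preimage of `e_j`).
[cite: Tits1979, §3.3.3] -/
theorem v_le_one_of_map_stdLattice_eq (A : GL (Fin N) K)
    (h : (stdLattice K N).map ((Matrix.toLin' (A : Matrix (Fin N) (Fin N) K)).restrictScalars 𝒪[K]) =
      stdLattice K N) :
    (∀ i j, Valued.v ((A : Matrix (Fin N) (Fin N) K) i j) ≤ 1) ∧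
      ∀ i j, Valued.v (((A⁻¹ : GL (Fin N) K) : Matrix (Fin N) (Fin N) K) i j) ≤ 1 := by
  constructor
  · intro i j
    have hmem : (A : Matrix (Fin N) (Fin N) K).mulVec (Pi.single j 1) ∈ stdLattice K N := by
      rw [← h]; exact ⟨Pi.single j 1, single_mem_stdLattice j, Matrix.toLin'_apply _ _⟩
    have hij := hmem i
    rwa [Matrix.mulVec_single_one] at hij
  · intro i j
    have hmem : (Pi.single j 1 : Fin N → K) ∈
        (stdLattice K N).map ((Matrix.toLin' (A : Matrix (Fin N) (Fin N) K)).restrictScalars 𝒪[K]) := by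
      rw [h]; exact single_mem_stdLattice j
    obtain ⟨u, hu, hAu⟩ := hmem
    rw [LinearMap.coe_restrictScalars, Matrix.toLin'_apply] at hAu
    have hu' : ((A⁻¹ : GL (Fin N) K) : Matrix (Fin N) (Fin N) K).mulVec (Pi.single j 1) = u := by
      rw [← hAu, Matrix.mulVec_mulVec, ← Units.val_mul, inv_mul_cancel, Units.val_one, Matrix.one_mulVec]
    have hij := hu i
    rwa [← hu', Matrix.mulVec_single_one] at hij

omit [Valued K ℤᵐ⁰] in
/-- A `σ`-fixed diagonal matrix with `d i · d (rev i) = 1` preserves `B₀`. [cite: Tits1979, §3.3.3] -/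
theorem B₀_diagonal_mulVec {d : Fin N → K} (hdσ : ∀ i, σ (d i) = d i) (hdinv : ∀ i, d i * d (Fin.rev i) = 1)
    (u v : Fin N → K) :
    B₀ σ N ((Matrix.diagonal d).mulVec u) ((Matrix.diagonal d).mulVec v) = B₀ σ N u v := by
  simp only [B₀_apply, Matrix.mulVec_diagonal, map_mul, hdσ]
  refine Finset.sum_congr rfl fun i _ => ?_
  calc d i * σ (u i) * (d (Fin.rev i) * v (Fin.rev i)) = (d i * d (Fin.rev i)) * (σ (u i) * v (Fin.rev i)) := by ring
    _ = σ (u i) * v (Fin.rev i) := by rw [hdinv, one_mul]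

/-- **Cartan decomposition of `U(σ, J₀)` relative to `U(σ, J₀) ∩ GL_N(𝒪)` — every residue characteristic**
(datum `UnramifiedLocalConjDatum σ ϖ`: `σ`-fixed uniformiser, (trace), (norm); the dyadic unramified case included).
For `g ∈ U(σ, J₀)` there are `k₁, k₂ ∈ U(σ, J₀)` with integral entries and integral inverses and `d : Fin N → K` with
`σ (d i) = d i` such that `k₁ g k₂ = diag(d)` (and `d i · d (rev i) = 1`).  Lattice proof:
`UnramifiedLocalConjDatum.exists_frame_cartan` for `M = g 𝒪^N`. [cite: Tits1979, §3.3.3; Jacobowitz1962, §7] -/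
theorem UnramifiedLocalConjDatum.exists_cartan_antidiagonal (hd : UnramifiedLocalConjDatum σ ϖ) (g : GL (Fin N) K)
    (hg : g ∈ unitaryGroupOfForm σ ((StdForm.antidiagonal N).over K)) :
    ∃ k₁ k₂ : GL (Fin N) K,
      k₁ ∈ unitaryGroupOfForm σ ((StdForm.antidiagonal N).over K) ∧
      (∀ i j, Valued.v ((k₁ : Matrix (Fin N) (Fin N) K) i j) ≤ 1) ∧
      (∀ i j, Valued.v (((k₁⁻¹ : GL (Fin N) K) : Matrix (Fin N) (Fin N) K) i j) ≤ 1) ∧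
      k₂ ∈ unitaryGroupOfForm σ ((StdForm.antidiagonal N).over K) ∧
      (∀ i j, Valued.v ((k₂ : Matrix (Fin N) (Fin N) K) i j) ≤ 1) ∧
      (∀ i j, Valued.v (((k₂⁻¹ : GL (Fin N) K) : Matrix (Fin N) (Fin N) K) i j) ≤ 1) ∧
      ∃ d : Fin N → K, ((k₁ * g * k₂ : GL (Fin N) K) : Matrix (Fin N) (Fin N) K) = Matrix.diagonal d ∧
        (∀ i, σ (d i) = d i) ∧ ∀ i, d i * d (Fin.rev i) = 1 := by
  -- `g` as a linear automorphism
  have hmul : ∀ a b : GL (Fin N) K, (Matrix.toLin' (a : Matrix (Fin N) (Fin N) K)).comp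
      (Matrix.toLin' (b : Matrix (Fin N) (Fin N) K)) = Matrix.toLin' ((a * b : GL (Fin N) K) : Matrix _ _ K) :=
    fun a b => by rw [Units.val_mul, Matrix.toLin'_mul]
  let gE : (Fin N → K) ≃ₗ[K] (Fin N → K) :=
    LinearEquiv.ofLinear (Matrix.toLin' (g : Matrix (Fin N) (Fin N) K))
      (Matrix.toLin' ((g⁻¹ : GL (Fin N) K) : Matrix (Fin N) (Fin N) K))
      (by rw [hmul, mul_inv_cancel, Units.val_one, Matrix.toLin'_one])
      (by rw [hmul, inv_mul_cancel, Units.val_one, Matrix.toLin'_one])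
  have hgE : ∀ u, gE u = (g : Matrix (Fin N) (Fin N) K).mulVec u := fun u => Matrix.toLin'_apply _ _
  have hgiso : ∀ u v, B₀ σ N (gE u) (gE v) = B₀ σ N u v := fun u v => by
    rw [hgE, hgE]; exact (mem_unitaryGroupOfForm_antidiagonal_iff g).1 hg u v
  -- `M = g 𝒪^N` is a unimodular lattice in `K^N = frame univ`
  have hrev : ∀ i ∈ (Finset.univ : Finset (Fin N)), Fin.rev i ∈ Finset.univ := fun _ _ => Finset.mem_univ _
  have hL := isUnimodularLattice_frameLattice (K := K) (N := N) hd.vσ hrev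
  have hM := hL.map_equiv' gE hgiso
  rw [frameLattice_univ, frame_univ, Submodule.map_top, LinearEquiv.range, ← frame_univ] at hM
  obtain ⟨ψ, d, hψiso, -, hψL, hdσ, hdinv, -, hEq⟩ := hd.exists_frame_cartan Finset.univ hrev _ hM
  rw [frameLattice_univ] at hEq
  -- the matrices `Ψ` of `ψ` and `T = diag(d)`
  have hcomp : ψ.toLinearMap.comp ψ.symm.toLinearMap = LinearMap.id := LinearMap.ext fun z => ψ.apply_symm_apply z
  have hcomp' : ψ.symm.toLinearMap.comp ψ.toLinearMap = LinearMap.id :=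
    LinearMap.ext fun z => ψ.symm_apply_apply z
  let Ψ : GL (Fin N) K :=
    ⟨LinearMap.toMatrix' ψ.toLinearMap, LinearMap.toMatrix' ψ.symm.toLinearMap,
      by rw [← LinearMap.toMatrix'_comp, hcomp, LinearMap.toMatrix'_id],
      by rw [← LinearMap.toMatrix'_comp, hcomp', LinearMap.toMatrix'_id]⟩
  have hΨ : Matrix.toLin' (Ψ : Matrix (Fin N) (Fin N) K) = ψ.toLinearMap := Matrix.toLin'_toMatrix' _
  have hd0 : ∀ i, d i ≠ 0 := fun i h => by have := hdinv i; rw [h, zero_mul] at this; exact zero_ne_one this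
  let T : GL (Fin N) K :=
    ⟨Matrix.diagonal d, Matrix.diagonal fun i => d (Fin.rev i),
      by rw [Matrix.diagonal_mul_diagonal, ← Matrix.diagonal_one]; exact congrArg _ (funext hdinv),
      by rw [Matrix.diagonal_mul_diagonal, ← Matrix.diagonal_one]
         exact congrArg _ (funext fun i => by rw [← Fin.rev_rev i, Fin.rev_rev (Fin.rev i)]; exact hdinv _)⟩
  -- unitarity of `Ψ` and `T`
  have hΨU : Ψ ∈ unitaryGroupOfForm σ ((StdForm.antidiagonal N).over K) := by
    rw [mem_unitaryGroupOfForm_antidiagonal_iff]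
    intro u v
    rw [← Matrix.toLin'_apply, ← Matrix.toLin'_apply, hΨ]
    exact hψiso u v
  have hTU : T ∈ unitaryGroupOfForm σ ((StdForm.antidiagonal N).over K) := by
    rw [mem_unitaryGroupOfForm_antidiagonal_iff]
    exact B₀_diagonal_mulVec hdσ hdinv
  -- `k := T⁻¹ Ψ⁻¹ g` stabilises `𝒪^N`
  have hLg : (stdLattice K N).map ((Matrix.toLin' (g : Matrix (Fin N) (Fin N) K)).restrictScalars 𝒪[K]) =
      ((stdLattice K N).map ((Matrix.toLin' (T : Matrix (Fin N) (Fin N) K)).restrictScalars 𝒪[K])).map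
        ((Matrix.toLin' (Ψ : Matrix (Fin N) (Fin N) K)).restrictScalars 𝒪[K]) := by
    rw [hΨ]; exact hEq
  set k : GL (Fin N) K := T⁻¹ * Ψ⁻¹ * g with hk
  have hkL : (stdLattice K N).map ((Matrix.toLin' (k : Matrix (Fin N) (Fin N) K)).restrictScalars 𝒪[K]) =
      stdLattice K N := by
    have hkval : (k : Matrix (Fin N) (Fin N) K) =
        ((T⁻¹ : GL (Fin N) K) : Matrix (Fin N) (Fin N) K) * (((Ψ⁻¹ : GL (Fin N) K) : Matrix (Fin N) (Fin N) K) *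
          (g : Matrix (Fin N) (Fin N) K)) := by
      rw [hk, Units.val_mul, Units.val_mul, Matrix.mul_assoc]
    rw [hkval, map_toLin'_mul, map_toLin'_mul, hLg,
      ← map_toLin'_mul ((Ψ⁻¹ : GL (Fin N) K) : Matrix (Fin N) (Fin N) K) ((Ψ : GL (Fin N) K) : Matrix (Fin N) (Fin N) K),
      ← Units.val_mul, inv_mul_cancel, Units.val_one, map_toLin'_one,
      ← map_toLin'_mul ((T⁻¹ : GL (Fin N) K) : Matrix (Fin N) (Fin N) K) ((T : GL (Fin N) K) : Matrix (Fin N) (Fin N) K),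
      ← Units.val_mul, inv_mul_cancel, Units.val_one, map_toLin'_one]
  have hΨL : (stdLattice K N).map ((Matrix.toLin' (Ψ : Matrix (Fin N) (Fin N) K)).restrictScalars 𝒪[K]) =
      stdLattice K N := by rw [hΨ]; exact hψL
  obtain ⟨hΨ1, hΨ2⟩ := v_le_one_of_map_stdLattice_eq Ψ hΨL
  obtain ⟨hk1, hk2⟩ := v_le_one_of_map_stdLattice_eq k hkL
  have hkU : k ∈ unitaryGroupOfForm σ ((StdForm.antidiagonal N).over K) :=
    Subgroup.mul_mem _ (Subgroup.mul_mem _ (Subgroup.inv_mem _ hTU) (Subgroup.inv_mem _ hΨU)) hg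
  refine ⟨Ψ⁻¹, k⁻¹, Subgroup.inv_mem _ hΨU, hΨ2, by rw [inv_inv]; exact hΨ1, Subgroup.inv_mem _ hkU, hk2,
    by rw [inv_inv]; exact hk1, d, ?_, hdσ, hdinv⟩
  have : Ψ⁻¹ * g * k⁻¹ = T := by rw [hk]; group
  rw [this]

/-- **Cartan decomposition of `U(σ, J₀)` relative to `U(σ, J₀) ∩ GL_N(𝒪)`.**  For `g ∈ U(σ, J₀)` there are
`k₁, k₂ ∈ U(σ, J₀)` with integral entries and integral inverses and `d : Fin N → K` with `σ (d i) = d i` such that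
`k₁ g k₂ = diag(d)` (and `d i · d (rev i) = 1`).  Lattice proof: `exists_frame_cartan` for `M = g 𝒪^N`; this is the
specialisation of `UnramifiedLocalConjDatum.exists_cartan_antidiagonal` to the non-dyadic datum
(`LocalConjDatum.toUnramified`). [cite: Tits1979, §3.3.3] -/
theorem exists_cartan_antidiagonal (hd : LocalConjDatum σ ϖ) (g : GL (Fin N) K)
    (hg : g ∈ unitaryGroupOfForm σ ((StdForm.antidiagonal N).over K)) :
    ∃ k₁ k₂ : GL (Fin N) K,
      k₁ ∈ unitaryGroupOfForm σ ((StdForm.antidiagonal N).over K) ∧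
      (∀ i j, Valued.v ((k₁ : Matrix (Fin N) (Fin N) K) i j) ≤ 1) ∧
      (∀ i j, Valued.v (((k₁⁻¹ : GL (Fin N) K) : Matrix (Fin N) (Fin N) K) i j) ≤ 1) ∧
      k₂ ∈ unitaryGroupOfForm σ ((StdForm.antidiagonal N).over K) ∧
      (∀ i j, Valued.v ((k₂ : Matrix (Fin N) (Fin N) K) i j) ≤ 1) ∧
      (∀ i j, Valued.v (((k₂⁻¹ : GL (Fin N) K) : Matrix (Fin N) (Fin N) K) i j) ≤ 1) ∧
      ∃ d : Fin N → K, ((k₁ * g * k₂ : GL (Fin N) K) : Matrix (Fin N) (Fin N) K) = Matrix.diagonal d ∧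
        (∀ i, σ (d i) = d i) ∧ ∀ i, d i * d (Fin.rev i) = 1 :=
  hd.toUnramified.exists_cartan_antidiagonal g hg

end Literature.NumberTheory.Automorphic.HermitianLattice

end
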